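import Summits.BirchSwinnertonDyer.BirchSwinnertonDyer.Theses.RamifiedSevenEllipticUnits
import Summits.BirchSwinnertonDyer.Rank1Residual.X11b.AnticyclotomicEulerChar
import Summits.BirchSwinnertonDyer.Rank1Residual.X11b.AnticyclotomicModuleFinite
import HarnessLib

set_option linter.dupNamespace false
set_option autoImplicit false

/-!
# Route `RamifiedSevenEllipticUnits` (rung K7r), crux `StrictControlSeven` (stmt-BirchSwinnertonDyer-19145):
# the `Λ`-side of (R-ctrl) DISCHARGED — the crux is EQUIVALENT to a cardinality identity for
# `H⁰(Γ, Sel_𝔭(K^ac_∞, E[7^∞]))` with no Iwasawa module, characteristic ideal or power series in it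

Cell `bsd-cm`, seat `bsd-cm-k7r-c4` (g0). HONEST FRAMING: nothing here closes the crux; BSD is not
proved by any of this; the item closes a rung leaf only when its own signature is proved.

## What is proved

The typed crux (R-ctrl) `O11.RamifiedCMStrictControlAt W p` reads, at every O11 frame of analytic
rank one and every anticyclotomic `κ` with topological generator `γ`: whenever the anticyclotomic
strict Selmer dual `X = X_ac^∅ = AcSelmer.XAc (W.baseChange K) p κ 𝔭 ∅ γ` has the shape
"`Λ`-torsion, `Ch_Λ(X) = (f)`, `f(0) ≠ 0`, `ord_p f(0) = n₀`" and `X[T]` is finite,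
`n₀ + log_p #X[T] = log_p #Sel_str(W/ℚ)[p^∞] + log_p #Sel_str(W'/ℚ)[p^∞]`. Memo O11-RAMIFIED-DESCENT
§3 derives it in three steps: (1) `K → ℚ` twist descent, (2) exact control, (3) the `Γ`-Euler
characteristic formula `#X/TX = |f(0)|_p⁻¹ · #X[T]`. THIS FILE DISCHARGES STEP (3) IN THE KERNEL,
for every elliptic curve over every number field, every prime, every `ℤ_p`-extension and every `𝔭`,
using the sibling cell's landed theorems on the CONSTRUCTED module (`X11b/AnticyclotomicEulerChar`,
`X11b/AnticyclotomicModuleFinite`, `X11b/AnticyclotomicDualPair`):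

* `eulerIdentity_of_hasCharValuationAt` — if `X_ac^∅` has the shape at `n₀` then
  `Sel^γ := H⁰(Γ, Sel_𝔭(K_∞, E[p^∞]))` is finite, `X[T]` is finite, and
  **`n₀ + log_p #X[T] = log_p #Sel^γ`** (`X_ac^∅` is finitely generated UNCONDITIONALLY,
  `XAc.module_finite_empty`; Greenberg's Lemma 4.2 on the dual pair, `XAc.card_of_hasCharValuationAt`;
  `#X[T] = #Sel_γ`, `XAc.natCard_invariants_eq`);
* `exists_hasCharValuationAt_and_finite_of_finite` — conversely `Sel^γ` finite gives the shape at
  some `n₀` and `X[T]` finite (`XAc.exists_hasCharValuationAt_of_finite`, `XAc.eulerChar`);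
* **`ramifiedCMStrictControlAt_iff_card`**: `O11.RamifiedCMStrictControlAt W p ↔` its `Λ`-FREE form
  (R-ctrl)♭ — same binders, and "`Sel^γ` finite ⟹ `log_p #Sel^γ = log_p #Sel_str(W/ℚ)[p^∞] +
  log_p #Sel_str(W'/ℚ)[p^∞]`" (written out; no new definition) — for every `W/ℚ` and every `p`;
  **`strictControlSeven_iff_card`**: the route item `StrictControlSeven` is EQUIVALENT to (R-ctrl)♭ on 𝒞₇.

So the open content of crux #4 is EXACTLY memo Steps (1)+(2): the order of the `Γ`-invariants of
Castella's strict Selmer group over the anticyclotomic tower versus the two strict Selmer groups over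
`ℚ` — bottom-layer exact control at the ramified prime plus quadratic-twist descent; no structure
theory of `Λ`-modules remains. The objects are the Literature ones (`Castella2018.AcSelmer.*`); the
sibling cell's `X11b.AcSelmer.*` twins are the same terms (`rfl`, cf.
`Partition/AnticyclotomicControlPublished` §0), which is how their theorems are applied.

References: [GreenbergLNM1716] §4 Lemma 4.2 (p. 102), §1 p. 60; [Castella2018] Def. 2.2, Thm. 2.3
(arXiv:1704.06608 p. 5); [CoatesSchneiderSujatha2003] §3 (30)–(31); [BurungaleKobayashiNakamuraOta2026]
Thm. 3.14, Thm. 6.1 (shape only; nothing used).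
-/

noncomputable section

open scoped Classical

open WeierstrassCurve NumberField IsDedekindDomain Field PowerSeries
  Literature.NumberTheory.EllipticCurves
  Literature.NumberTheory.EllipticCurves.Rank1Residual
  Literature.NumberTheory.GaloisRepresentations
  Summit.BirchSwinnertonDyer.Rank1Residual
  Summit.BirchSwinnertonDyer.Rank1Residual.Additive

namespace Summit.BirchSwinnertonDyer.BirchSwinnertonDyer.Theorems.RamifiedSevenEllipticUnits

/-! ## §1 One curve over one number field: the `Λ`-numbers of `X_ac^∅` are `Γ`-Euler-characteristic numbers -/

section EulerChar

universe u

variable {K : Type u} [Field K] [NumberField K] (E : WeierstrassCurve K) [E.IsElliptic]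
  (p : ℕ) [Fact p.Prime] (κ : ZpExtension K p) (𝔭 : HeightOneSpectrum (𝓞 K))
  (γ : absoluteGaloisGroup K) [Fact (κ.IsTopGenerator γ)]

omit [E.IsElliptic] in
/-- `#X_ac^∅[T]` as the subtype of the crux's display equals `#` of the tree's `invariants` submodule
(`Submodule.torsionBy Λ X T`); the Literature module `Castella2018.AcSelmer.XAc` and the sibling cell's
`X11b.AcSelmer.XAc` are the same term. [folklore] -/
theorem natCard_subtype_X_smul_eq_natCard_invariants :
    Nat.card {x : Castella2018.AcSelmer.XAc E p κ 𝔭 ∅ γ //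
        (PowerSeries.X : IwasawaAlgebra p) • x = 0} =
      Nat.card (IwasawaAlgebra.invariants p (X11b.AcSelmer.XAc E p κ 𝔭 ∅ γ)) :=
  Nat.card_congr
    { toFun := fun x ↦ ⟨x.1, (Submodule.mem_torsionBy_iff _ _).mpr x.2⟩
      invFun := fun x ↦ ⟨x.1, (Submodule.mem_torsionBy_iff _ _).mp x.2⟩
      left_inv := fun _ ↦ rfl
      right_inv := fun _ ↦ rfl }

/-- **Step (3) of the memo, in the kernel.** If `X_ac^∅(E[p^∞])` is `Λ`-torsion with
`Ch_Λ = (f)`, `f(0) ≠ 0`, `ord_p f(0) = n₀` (the Literature shape `XAc.HasCharValuationAt … n₀`), then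
`Sel^γ = H⁰(Γ, Sel_𝔭(K_∞, E[p^∞]))` is finite, `X[T]` is finite, and
`n₀ + log_p #X[T] = log_p #Sel^γ`. Ingredients: `X_ac^∅` finitely generated (`XAc.module_finite_empty`,
unconditional), Greenberg's Lemma 4.2 on the dual pair (`XAc.card_of_hasCharValuationAt`:
`#Sel^γ = p^{n₀} · #Sel_γ`), `#X[T] = #Sel_γ` (`XAc.natCard_invariants_eq`).
[cite: GreenbergLNM1716, §4 Lemma 4.2 (p. 102)] [cite: Castella2018, Thm. 2.3 (arXiv:1704.06608 p. 5)] -/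
theorem eulerIdentity_of_hasCharValuationAt {n₀ : ℕ}
    (h : Castella2018.AcSelmer.XAc.HasCharValuationAt E p κ 𝔭 ∅ γ n₀) :
    Finite (IwasawaDual.endInvariants (Castella2018.AcSelmer.conjSelmerAc E p κ 𝔭 ∅ γ - 1)) ∧
      Finite {x : Castella2018.AcSelmer.XAc E p κ 𝔭 ∅ γ //
        (PowerSeries.X : IwasawaAlgebra p) • x = 0} ∧
      n₀ + padicValNat p (Nat.card {x : Castella2018.AcSelmer.XAc E p κ 𝔭 ∅ γ //
          (PowerSeries.X : IwasawaAlgebra p) • x = 0}) =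
        padicValNat p (Nat.card
          (IwasawaDual.endInvariants (Castella2018.AcSelmer.conjSelmerAc E p κ 𝔭 ∅ γ - 1))) := by
  -- the Literature shape IS the sibling cell's shape (same term)
  have h' : X11b.AcSelmer.XAc.HasCharValuationAt E p κ 𝔭 ∅ γ n₀ := h
  haveI : Module.Finite (IwasawaAlgebra p) (X11b.AcSelmer.XAc E p κ 𝔭 ∅ γ) :=
    X11b.AcSelmer.XAc.module_finite_empty (W := E) (p := p) κ 𝔭 γ
  obtain ⟨hfin, hcard⟩ := X11b.AcSelmer.XAc.card_of_hasCharValuationAt E p κ 𝔭 ∅ γ h'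
  obtain ⟨hT, f, hf, -, -⟩ := h'
  haveI := hfin
  obtain ⟨hcofin, -, -, -⟩ := X11b.AcSelmer.XAc.eulerChar E p κ 𝔭 ∅ γ hT f hf hfin
  haveI := hcofin
  obtain ⟨b, hb⟩ := X11b.AcSelmer.exists_natCard_endCoinvariants_eq_pow E p κ 𝔭 ∅ γ
  have hinv : Nat.card {x : Castella2018.AcSelmer.XAc E p κ 𝔭 ∅ γ //
      (PowerSeries.X : IwasawaAlgebra p) • x = 0} = p ^ b := by
    rw [natCard_subtype_X_smul_eq_natCard_invariants, X11b.AcSelmer.XAc.natCard_invariants_eq, hb]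
  have hfinT : Finite {x : Castella2018.AcSelmer.XAc E p κ 𝔭 ∅ γ //
      (PowerSeries.X : IwasawaAlgebra p) • x = 0} :=
    Nat.finite_of_card_ne_zero (by rw [hinv]; exact pow_ne_zero _ (Fact.out : p.Prime).ne_zero)
  refine ⟨hfin, hfinT, ?_⟩
  have e1 : Nat.card (IwasawaDual.endInvariants
      (Castella2018.AcSelmer.conjSelmerAc E p κ 𝔭 ∅ γ - 1)) = p ^ (n₀ + b) := by
    rw [pow_add, ← hb]; exact hcard
  rw [hinv, e1, padicValNat.prime_pow, padicValNat.prime_pow]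

/-- **Converse bookkeeping.** If `Sel^γ = H⁰(Γ, Sel_𝔭(K_∞, E[p^∞]))` is finite then `X_ac^∅` has the
Literature shape at some `n₀` (`XAc.exists_hasCharValuationAt_of_finite`: Greenberg's torsion
criterion + `Λ` factorial + Lemma 4.2) and `X[T]` is finite.
[cite: GreenbergLNM1716, §1 p. 60 and §4 Lemma 4.2 (p. 102)] -/
theorem exists_hasCharValuationAt_and_finite_of_finite
    (hfin : Finite (IwasawaDual.endInvariants (Castella2018.AcSelmer.conjSelmerAc E p κ 𝔭 ∅ γ - 1))) :
    ∃ n₀ : ℕ, Castella2018.AcSelmer.XAc.HasCharValuationAt E p κ 𝔭 ∅ γ n₀ ∧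
      Finite {x : Castella2018.AcSelmer.XAc E p κ 𝔭 ∅ γ //
        (PowerSeries.X : IwasawaAlgebra p) • x = 0} := by
  have hfin' : Finite (IwasawaDual.endInvariants (X11b.AcSelmer.conjSelmerAc E p κ 𝔭 ∅ γ - 1)) :=
    hfin
  obtain ⟨n₀, hn₀⟩ := X11b.AcSelmer.XAc.exists_hasCharValuationAt_of_finite E p κ 𝔭 ∅ γ hfin'
  have h : Castella2018.AcSelmer.XAc.HasCharValuationAt E p κ 𝔭 ∅ γ n₀ := hn₀
  exact ⟨n₀, h, (eulerIdentity_of_hasCharValuationAt E p κ 𝔭 γ h).2.1⟩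

end EulerChar

/-! ## §2 (R-ctrl) ⟺ its `Λ`-free form (R-ctrl)♭

The `Λ`-FREE form (R-ctrl)♭ of the typed crux `O11.RamifiedCMStrictControlAt W p` — written out in
the statements below, no new definition — has the SAME binders as the crux (an O11 frame
`(K, 𝔭, W', C)` of `(W, p)` with `r_an(W) = 1`, an anticyclotomic `ℤ_p`-extension `κ` with topological
generator `γ`, generators `P`, `P'` of `W(ℚ)`, `W'(ℚ)` modulo torsion with exact `p`-divisibility
levels `n`, `n'`) and says: IF `Sel^γ := H⁰(Γ, Sel_𝔭(K^ac_∞, E[p^∞]))` (the `γ`-invariants of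
Castella's strict-at-`𝔭`, everywhere-locally-trivial Selmer group over the tower,
`Castella2018.AcSelmer.selmerAc … ∅`) is finite, THEN
`log_p #Sel^γ = log_p #Sel_str(W/ℚ)[p^∞] + log_p #Sel_str(W'/ℚ)[p^∞]`. Its content is bottom-layer
exact control `Sel_𝔭(K, E[p^∞]) ≅ Sel_𝔭(K_∞, E[p^∞])^Γ` (memo §3 Step 2: `E(K^ac_{∞,𝔭})[p^∞] = 0`,
BKNO (3.16); (LV1)–(LV3)) plus the twist descent `Sel_𝔭(K, E[p^∞]) ≅ Sel_str(E/ℚ) ⊕ Sel_str(E'/ℚ)`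
(Step 1) — no `Λ`-module is left. -/

section Card

variable (W : WeierstrassCurve ℚ) [W.IsElliptic] (p : ℕ) [Fact p.Prime]

/-- **(R-ctrl) ⟺ (R-ctrl)♭** for every `W/ℚ` and every prime `p`: the typed crux
`O11.RamifiedCMStrictControlAt W p` IS the `Λ`-free bottom-layer control identity (statement in the
module docstring §2). (→): given `Sel^γ` finite, the shape holds at some `n₀` with `X[T]` finite (§1
converse), (R-ctrl) gives `n₀ + log_p #X[T] = RHS`, and §1 rewrites the left side as `log_p #Sel^γ`.
(←): given the shape at `n₀`, §1 gives `Sel^γ` finite and `n₀ + log_p #X[T] = log_p #Sel^γ`.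
[cite: GreenbergLNM1716, §4 Lemma 4.2 (p. 102)] [cite: BurungaleKobayashiNakamuraOta2026, (3.16) and Thm. 6.1 (arXiv:2608.06879; shape only)] -/
theorem ramifiedCMStrictControlAt_iff_card :
    X12.O11.RamifiedCMStrictControlAt W p ↔
      ∀ (K : Type) [Field K] [NumberField K] (𝔭 : HeightOneSpectrum (𝓞 K))
        (W' : WeierstrassCurve ℚ) [W'.IsElliptic] [W'.IsGloballyMinimal] (C : VariableChange ℚ),
        X12.O11.IsFrame W p K 𝔭 W' C → W.analyticRank = 1 →
        ∀ (κ : ZpExtension K p), κ.IsAnticyclotomic →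
          ∀ (γ : absoluteGaloisGroup K) [Fact (κ.IsTopGenerator γ)]
            (P : W.toAffine.Point) (n : ℕ) (P' : W'.toAffine.Point) (n' : ℕ),
            ¬ IsOfFinAddOrder P →
            (∀ R : W.toAffine.Point, ∃ (k : ℤ) (T : W.toAffine.Point),
              IsOfFinAddOrder T ∧ R = k • P + T) →
            (∀ Q : (W.baseChange ℚ_[p]).toAffine.Point, p • Q = 0 → Q = 0) →
            (∃ Q : (W.baseChange ℚ_[p]).toAffine.Point, p ^ n • Q = W.toPadicPoint p P) →
            (∀ Q : (W.baseChange ℚ_[p]).toAffine.Point, p ^ (n + 1) • Q ≠ W.toPadicPoint p P) →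
            ¬ IsOfFinAddOrder P' →
            (∀ R : W'.toAffine.Point, ∃ (k : ℤ) (T : W'.toAffine.Point),
              IsOfFinAddOrder T ∧ R = k • P' + T) →
            (∀ Q : (W'.baseChange ℚ_[p]).toAffine.Point, p • Q = 0 → Q = 0) →
            (∃ Q : (W'.baseChange ℚ_[p]).toAffine.Point, p ^ n' • Q = W'.toPadicPoint p P') →
            (∀ Q : (W'.baseChange ℚ_[p]).toAffine.Point,
              p ^ (n' + 1) • Q ≠ W'.toPadicPoint p P') →
            Finite (IwasawaDual.endInvariants
              (Castella2018.AcSelmer.conjSelmerAc (W.baseChange K) p κ 𝔭 ∅ γ - 1)) →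
              padicValNat p (Nat.card (IwasawaDual.endInvariants
                  (Castella2018.AcSelmer.conjSelmerAc (W.baseChange K) p κ 𝔭 ∅ γ - 1))) =
                padicValNat p (Nat.card ↥(strictSelmerPInfty W p)) +
                  padicValNat p (Nat.card ↥(strictSelmerPInfty W' p)) := by
  constructor
  · intro h K _ _ 𝔭 W' _ _ C hF hr κ hκ γ _ P n P' n' h1 h2 h3 h4 h5 h6 h7 h8 h9 h10 hfin
    obtain ⟨n₀, hchar, hfinT⟩ :=
      exists_hasCharValuationAt_and_finite_of_finite (W.baseChange K) p κ 𝔭 γ hfin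
    have hctrl := h K 𝔭 W' C hF hr κ hκ γ P n P' n' h1 h2 h3 h4 h5 h6 h7 h8 h9 h10 n₀ hchar hfinT
    obtain ⟨-, -, heuler⟩ := eulerIdentity_of_hasCharValuationAt (W.baseChange K) p κ 𝔭 γ hchar
    have heuler' : ((n₀ : ℤ) + padicValNat p (Nat.card {x : Castella2018.AcSelmer.XAc
        (W.baseChange K) p κ 𝔭 ∅ γ // (PowerSeries.X : IwasawaAlgebra p) • x = 0})) =
        (padicValNat p (Nat.card (IwasawaDual.endInvariants
          (Castella2018.AcSelmer.conjSelmerAc (W.baseChange K) p κ 𝔭 ∅ γ - 1))) : ℤ) := by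
      exact_mod_cast heuler
    rw [heuler'] at hctrl
    exact_mod_cast hctrl
  · intro h K _ _ 𝔭 W' _ _ C hF hr κ hκ γ _ P n P' n' h1 h2 h3 h4 h5 h6 h7 h8 h9 h10 n₀ hchar _
    obtain ⟨hfin, -, heuler⟩ := eulerIdentity_of_hasCharValuationAt (W.baseChange K) p κ 𝔭 γ hchar
    have hcard := h K 𝔭 W' C hF hr κ hκ γ P n P' n' h1 h2 h3 h4 h5 h6 h7 h8 h9 h10 hfin
    have heuler' : ((n₀ : ℤ) + padicValNat p (Nat.card {x : Castella2018.AcSelmer.XAc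
        (W.baseChange K) p κ 𝔭 ∅ γ // (PowerSeries.X : IwasawaAlgebra p) • x = 0})) =
        (padicValNat p (Nat.card (IwasawaDual.endInvariants
          (Castella2018.AcSelmer.conjSelmerAc (W.baseChange K) p κ 𝔭 ∅ γ - 1))) : ℤ) := by
      exact_mod_cast heuler
    rw [heuler']
    exact_mod_cast hcard

end Card

/-! ## §3 The route item -/

/-- **`StrictControlSeven` ⟺ (R-ctrl)♭ on 𝒞₇**: the route item (crux #4, stmt-BirchSwinnertonDyer-19145)
is EQUIVALENT to the `Λ`-free statement "for every global minimal `W ∈ 𝒞₇`, every frame at `7`,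
every anticyclotomic `κ` with topological generator `γ`, all generator data:
`H⁰(Γ, Sel_𝔭(K^ac_∞, E[7^∞]))` finite ⟹
`log₇ #H⁰(Γ, Sel_𝔭(K^ac_∞, E[7^∞])) = log₇ #Sel_str(W/ℚ)[7^∞] + log₇ #Sel_str(W'/ℚ)[7^∞]`" — no
Iwasawa module, characteristic ideal or power series remains in the crux.
[cite: GreenbergLNM1716, §4 Lemma 4.2 (p. 102)] [cite: BurungaleKobayashiNakamuraOta2026, Thm. 6.1 (arXiv:2608.06879; shape only)] -/
theorem strictControlSeven_iff_card :
    Summit.BirchSwinnertonDyer.BirchSwinnertonDyer.Theses.RamifiedSevenEllipticUnits.StrictControlSeven ↔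
      ∀ (W : WeierstrassCurve ℚ) [W.IsElliptic] [W.IsGloballyMinimal] [Fact (Nat.Prime 7)],
        X12.ClassCSeven W →
      ∀ (K : Type) [Field K] [NumberField K] (𝔭 : HeightOneSpectrum (𝓞 K))
        (W' : WeierstrassCurve ℚ) [W'.IsElliptic] [W'.IsGloballyMinimal] (C : VariableChange ℚ),
        X12.O11.IsFrame W 7 K 𝔭 W' C → W.analyticRank = 1 →
        ∀ (κ : ZpExtension K 7), κ.IsAnticyclotomic →
          ∀ (γ : absoluteGaloisGroup K) [Fact (κ.IsTopGenerator γ)]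
            (P : W.toAffine.Point) (n : ℕ) (P' : W'.toAffine.Point) (n' : ℕ),
            ¬ IsOfFinAddOrder P →
            (∀ R : W.toAffine.Point, ∃ (k : ℤ) (T : W.toAffine.Point),
              IsOfFinAddOrder T ∧ R = k • P + T) →
            (∀ Q : (W.baseChange ℚ_[7]).toAffine.Point, 7 • Q = 0 → Q = 0) →
            (∃ Q : (W.baseChange ℚ_[7]).toAffine.Point, 7 ^ n • Q = W.toPadicPoint 7 P) →
            (∀ Q : (W.baseChange ℚ_[7]).toAffine.Point, 7 ^ (n + 1) • Q ≠ W.toPadicPoint 7 P) →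
            ¬ IsOfFinAddOrder P' →
            (∀ R : W'.toAffine.Point, ∃ (k : ℤ) (T : W'.toAffine.Point),
              IsOfFinAddOrder T ∧ R = k • P' + T) →
            (∀ Q : (W'.baseChange ℚ_[7]).toAffine.Point, 7 • Q = 0 → Q = 0) →
            (∃ Q : (W'.baseChange ℚ_[7]).toAffine.Point, 7 ^ n' • Q = W'.toPadicPoint 7 P') →
            (∀ Q : (W'.baseChange ℚ_[7]).toAffine.Point,
              7 ^ (n' + 1) • Q ≠ W'.toPadicPoint 7 P') →
            Finite (IwasawaDual.endInvariants
              (Castella2018.AcSelmer.conjSelmerAc (W.baseChange K) 7 κ 𝔭 ∅ γ - 1)) →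
              padicValNat 7 (Nat.card (IwasawaDual.endInvariants
                  (Castella2018.AcSelmer.conjSelmerAc (W.baseChange K) 7 κ 𝔭 ∅ γ - 1))) =
                padicValNat 7 (Nat.card ↥(strictSelmerPInfty W 7)) +
                  padicValNat 7 (Nat.card ↥(strictSelmerPInfty W' 7)) :=
  ⟨fun h W _ _ _ hC ↦ (ramifiedCMStrictControlAt_iff_card W 7).mp (h W hC),
    fun h W _ _ _ hC ↦ (ramifiedCMStrictControlAt_iff_card W 7).mpr (h W hC)⟩

/-- **Crux #4 `StrictControlSeven` ⟸ (R-ctrl)♭ on 𝒞₇** (the direction a prover of the `Λ`-free form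
uses to close the item). [cite: GreenbergLNM1716, §4 Lemma 4.2 (p. 102)] -/
theorem strictControlSeven_of_card
    (h :       ∀ (W : WeierstrassCurve ℚ) [W.IsElliptic] [W.IsGloballyMinimal] [Fact (Nat.Prime 7)],
        X12.ClassCSeven W →
      ∀ (K : Type) [Field K] [NumberField K] (𝔭 : HeightOneSpectrum (𝓞 K))
        (W' : WeierstrassCurve ℚ) [W'.IsElliptic] [W'.IsGloballyMinimal] (C : VariableChange ℚ),
        X12.O11.IsFrame W 7 K 𝔭 W' C → W.analyticRank = 1 →
        ∀ (κ : ZpExtension K 7), κ.IsAnticyclotomic →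
          ∀ (γ : absoluteGaloisGroup K) [Fact (κ.IsTopGenerator γ)]
            (P : W.toAffine.Point) (n : ℕ) (P' : W'.toAffine.Point) (n' : ℕ),
            ¬ IsOfFinAddOrder P →
            (∀ R : W.toAffine.Point, ∃ (k : ℤ) (T : W.toAffine.Point),
              IsOfFinAddOrder T ∧ R = k • P + T) →
            (∀ Q : (W.baseChange ℚ_[7]).toAffine.Point, 7 • Q = 0 → Q = 0) →
            (∃ Q : (W.baseChange ℚ_[7]).toAffine.Point, 7 ^ n • Q = W.toPadicPoint 7 P) →
            (∀ Q : (W.baseChange ℚ_[7]).toAffine.Point, 7 ^ (n + 1) • Q ≠ W.toPadicPoint 7 P) →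
            ¬ IsOfFinAddOrder P' →
            (∀ R : W'.toAffine.Point, ∃ (k : ℤ) (T : W'.toAffine.Point),
              IsOfFinAddOrder T ∧ R = k • P' + T) →
            (∀ Q : (W'.baseChange ℚ_[7]).toAffine.Point, 7 • Q = 0 → Q = 0) →
            (∃ Q : (W'.baseChange ℚ_[7]).toAffine.Point, 7 ^ n' • Q = W'.toPadicPoint 7 P') →
            (∀ Q : (W'.baseChange ℚ_[7]).toAffine.Point,
              7 ^ (n' + 1) • Q ≠ W'.toPadicPoint 7 P') →
            Finite (IwasawaDual.endInvariants
              (Castella2018.AcSelmer.conjSelmerAc (W.baseChange K) 7 κ 𝔭 ∅ γ - 1)) →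
              padicValNat 7 (Nat.card (IwasawaDual.endInvariants
                  (Castella2018.AcSelmer.conjSelmerAc (W.baseChange K) 7 κ 𝔭 ∅ γ - 1))) =
                padicValNat 7 (Nat.card ↥(strictSelmerPInfty W 7)) +
                  padicValNat 7 (Nat.card ↥(strictSelmerPInfty W' 7))) :
    Summit.BirchSwinnertonDyer.BirchSwinnertonDyer.Theses.RamifiedSevenEllipticUnits.StrictControlSeven :=
  strictControlSeven_iff_card.mpr h

end Summit.BirchSwinnertonDyer.BirchSwinnertonDyer.Theorems.RamifiedSevenEllipticUnits

end
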